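import Summits.HodgeConjecture.CorCM.ConjSqrtCMFieldPairsHodge
import Summits.HodgeConjecture.CorCM.CMFamilyRankClosureBound
import Summits.HodgeConjecture.CorCM.ImaginaryQuadraticTimesSimpleCMSurfaceHodge
import Summits.HodgeConjecture.CorCM.PairwiseCMFamiliesHodge
import HarnessLib

/-!
# Two simple CM abelian surfaces with DIFFERENT Galois closures: the Hodge conjecture for every `S₀^a × S₁^b` —
# the proper normal subfields of the Galois closure of a quartic CM field are totally real

COR-CM (cell `pub-hodgecm2`, binder seat `b23` gen 28), count-neutral; NEW as stated, hence under `Summits/`.  The field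
lemma behind it: for a quartic CM field `K` which is NOT biquadratic (cyclic Galois, or non-Galois with dihedral closure
of degree `8`), **every normal subfield `M ⊊ L = normalClosure ℚ K ℂ` is fixed pointwise by complex conjugation**
(`conj_apply_eq_of_ne_normalClosure_quartic`):

* `K` cyclic: `M ⊊ L = ι(K)` has degree `≤ 2` and conjugation is a square in `Gal(K/ℚ)`
  (`conj_apply_eq_of_isSquare_conjGal_of_finrank_le_two`, seat b23 gen 27);
* `K` non-Galois (`conj_apply_eq_of_ne_normalClosure_of_not_isGalois`): with the four embeddings `a, ā, b, b̄`, the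
  `4`-cycle `τ ∈ Aut(ℂ)` (`τa = b`, `τb = ā`; seat p2) and the reflection `τ₀` (`τ₀a = a`, `τ₀b = b̄`; seat p2) satisfy ON
  `L`: `τ² = conj`, `τ₀² = 1`, `(τ₀τ)² = 1` (checked on the four embeddings, which generate `L`).  Restricted to a normal
  `M ⊊ L` (`[M : ℚ] ∈ {1, 2, 4}` as `[L : ℚ] = 8`) they land in `Gal(M/ℚ)`, a group of order `≤ 4`, hence COMMUTATIVE
  (order `4 = 2²`: Mathlib's `IsPGroup.isMulCommutative_of_card_eq_prime_sq`); there `(τ₀τ)² = τ₀²τ² = τ²`, so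
  `conj|_M = τ²|_M = 1` (degree `≤ 2`: `conj_apply_eq_of_apply_apply_eq_conj_of_not_dvd`, seat b23).

Consequences (two slots `i₀ ≠ i₁`, quartic CM fields `K_{i₀}`, `K_{i₁}`, not biquadratic, with `L₀ ≠ L₁`: then
`L₀ ∩ L₁` is a proper normal subfield of `L₀` or of `L₁`):

* **`conj_apply_eq_of_mem_inf_of_normalClosure_ne`** — conjugation fixes `L₀ ∩ L₁` pointwise, so both slots carry
  PARTIAL CONJUGATIONS;
* **`hodgeConjectureFor_prod_surfaces_of_normalClosure_ne`** — every CM type of such a field is primitive and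
  nondegenerate, so the Hodge conjecture and `B• = D•` hold on every `S₀^a × S₁^b` (every `⨁_{j<N} A_{π j}`) of
  realisations, UNCONDITIONALLY; **`hodgeConjectureFor_prod_simpleSurfaces_of_normalClosure_ne`** — the same for two SIMPLE
  CM abelian surfaces with quartic CM fields of different Galois closures (simple ⟹ primitive type ⟹ the field is not
  biquadratic), with no further hypothesis;
* **`hodgeConjectureFor_prod_curves_surfaces_of_normalClosure_ne`** — seat p2's menu (`PairwiseCMFamiliesHodge`, BY NAME)
  with its pairwise real-intersection hypothesis DISCHARGED: the Hodge conjecture on every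
  `E_1^{a_1} × ⋯ × E_r^{a_r} × S_1^{c_1} × ⋯ × S_m^{c_m}` for pairwise non-isogenous CM elliptic curves and simple CM abelian
  surfaces with pairwise different Galois closures (cyclic or not).

What is NOT covered: two simple CM surfaces with the SAME Galois closure — same field, inequivalent types (seat b24's
`QuarticCMTypePairNondegenerate`: nondegenerate) or a field and its reflex field (same dihedral closure; open here).
Theorems only, no definition, no `sorry`.

## References

* [Shimura1998] G. Shimura, *Abelian Varieties with Complex Multiplication and Modular Functions*, §8.4 Example (2)
  (B), (C) (cyclic and dihedral quartic CM fields).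
* [Gordon1999HodgeAVSurvey] B. B. Gordon, *A survey of the Hodge conjecture for abelian varieties*, §3 Theorem (proof),
  7.5, 10.10.
* [MoonenZarhin1999LowDim] B. Moonen, Yu. Zarhin, Math. Ann. 315 (1999), Cor. (3.9) and "Hodge groups of simple
  abelian surfaces of CM-type".
* [Lang2002] S. Lang, *Algebra*, 3rd ed., VI §1 Thm. 1.1, Cor. 1.4; I §6 (groups of order `p²`).
-/

noncomputable section

open CategoryTheory CategoryTheory.Limits NumberField NumberField.ComplexEmbedding IntermediateField Module

namespace Summit.HodgeConjecture.CorCM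

open Literature.NumberTheory.ComplexMultiplication
open Literature.AlgebraicGeometry.Motives (AbelianVariety CMType)
open Literature.AlgebraicGeometry.HodgeTheory
open Literature.AlgebraicGeometry.ComplexMultiplication (IsCMTypeRealisation isSimple_iff_isPrimitive)
open Literature.AlgebraicGeometry.VanGeemen1994 (hodgeClassSpan)
open Literature.AlgebraicGeometry.Pohlmann1968
open Literature.Barriers.HodgeConjecture (divisorClassesSpan)

/-! ### Proper normal subfields of the Galois closure of a quartic CM field are totally real -/

section Fields

variable {I : Type} {K : I → Type} [∀ i, Field (K i)] [∀ i, NumberField (K i)] [∀ i, IsCMField (K i)]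

/-- A subfield of a finite extension (inside `ℂ`) is finite. [folklore] -/
private theorem finiteDimensional_of_le₈ {E E' : IntermediateField ℚ ℂ} [FiniteDimensional ℚ E] (h : E' ≤ E) :
    FiniteDimensional ℚ E' :=
  FiniteDimensional.of_injective (IntermediateField.inclusion h).toLinearMap (IntermediateField.inclusion_injective h)

/-- An automorphism of `ℂ` fixes `ℚ`. [folklore] -/
private theorem ringEquiv_apply_algebraMap₈ (g : ℂ ≃+* ℂ) (q : ℚ) : g (algebraMap ℚ ℂ q) = algebraMap ℚ ℂ q := by
  rw [eq_ratCast]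
  exact map_ratCast g q

/-- **Non-Galois quartic CM field: every normal `M ⊊ L` is fixed pointwise by conjugation.**  On the four embeddings
`a, ā, b, b̄` the `4`-cycle `τ` and the reflection `τ₀` of `Aut(ℂ)` satisfy `τ² = conj`, `τ₀² = 1`, `(τ₀τ)² = 1` on `L`;
in the commutative group `Gal(M/ℚ)` (order `1`, `2` or `4`) this forces `conj|_M = τ²|_M = τ₀²τ²|_M = (τ₀τ)²|_M = 1`.
[cite: Shimura1998, §8.4 Example (2)(C)] [cite: Lang2002, I §6] -/
theorem conj_apply_eq_of_ne_normalClosure_of_not_isGalois (i : I) (h4 : finrank ℚ (K i) = 4)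
    (hK : ¬ IsGalois ℚ (K i)) (M : IntermediateField ℚ ℂ) [FiniteDimensional ℚ M]
    [@Normal ℚ M _ _ (IntermediateField.algebra' M)] (hM : M ≤ normalClosure ℚ (K i) ℂ)
    (hne : M ≠ normalClosure ℚ (K i) ℂ) {x : ℂ} (hx : x ∈ M) : starRingEnd ℂ x = x := by
  letI iM : Algebra ℚ ↥M := IntermediateField.algebra' M
  haveI : Algebra.IsSeparable ℚ ↥M := Algebra.IsAlgebraic.isSeparable_of_perfectField
  haveI : IsGalois ℚ ↥M := ⟨⟩
  -- the four embeddings and the dihedral generators inside `Aut(ℂ)`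
  obtain ⟨a⟩ : Nonempty (K i →+* ℂ) := inferInstance
  obtain ⟨b, hba, hba'⟩ := QuarticCM.exists_ne_ne_conjugate h4 a
  obtain ⟨τ, hτa, hτb⟩ := QuarticCM.exists_ringAut_smul_eq_smul_eq_conjugate h4 hK hba hba'
  obtain ⟨τ₀, hτ₀a, hτ₀b⟩ := QuarticCM.exists_ringAut_smul_eq_self_smul_eq_conjugate_of_not_isGalois h4 hK hba hba'
  have hτa' : τ • conjugate a = conjugate b := by rw [QuarticCM.smul_conjugate, hτa]
  have hτb' : τ • conjugate b = a := by rw [QuarticCM.smul_conjugate, hτb, involutive_conjugate (K i) a]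
  have hτ₀a' : τ₀ • conjugate a = conjugate a := by rw [QuarticCM.smul_conjugate, hτ₀a]
  have hτ₀b' : τ₀ • conjugate b = b := by rw [QuarticCM.smul_conjugate, hτ₀b, involutive_conjugate (K i) b]
  -- the relations, checked on `a, ā, b, b̄`
  have h1 : ∀ s : K i →+* ℂ, (τ * τ) • s = (starRingAut : ℂ ≃+* ℂ) • s := by
    intro s
    rw [mul_smul, conj_smul_eq_conjugate]
    rcases QuarticCM.eq_or_eq_or_eq_or_eq h4 hba hba' s with rfl | rfl | rfl | rfl
    · rw [hτa, hτb]
    · rw [hτa', hτb', involutive_conjugate (K i) a]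
    · rw [hτb, hτa']
    · rw [hτb', hτa, involutive_conjugate (K i) b]
  have h2 : ∀ s : K i →+* ℂ, (τ₀ * τ * (τ₀ * τ)) • s = (1 : ℂ ≃+* ℂ) • s := by
    intro s
    rw [one_smul, mul_smul, mul_smul, mul_smul]
    rcases QuarticCM.eq_or_eq_or_eq_or_eq h4 hba hba' s with rfl | rfl | rfl | rfl
    · rw [hτa, hτ₀b, hτb', hτ₀a]
    · rw [hτa', hτ₀b', hτb, hτ₀a']
    · rw [hτb, hτ₀a', hτa', hτ₀b']
    · rw [hτb', hτ₀a, hτa, hτ₀b]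
  have h3 : ∀ s : K i →+* ℂ, (τ₀ * τ₀) • s = (1 : ℂ ≃+* ℂ) • s := by
    intro s
    rw [one_smul, mul_smul]
    rcases QuarticCM.eq_or_eq_or_eq_or_eq h4 hba hba' s with rfl | rfl | rfl | rfl
    · rw [hτ₀a, hτ₀a]
    · rw [hτ₀a', hτ₀a']
    · rw [hτ₀b, hτ₀b']
    · rw [hτ₀b', hτ₀b]
  -- hence on `L`, hence on `M ≤ L`
  have hL1 : ∀ y : ℂ, y ∈ M → τ (τ y) = starRingEnd ℂ y := fun y hy => by
    have h := apply_eq_of_forall_smul_eq i h1 (hM hy)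
    rwa [RingAut.mul_apply, starRingAut_apply, ← starRingEnd_apply] at h
  have hL2 : ∀ y : ℂ, y ∈ M → τ₀ (τ (τ₀ (τ y))) = y := fun y hy => by
    have h := apply_eq_of_forall_smul_eq i h2 (hM hy)
    rwa [RingAut.mul_apply, RingAut.mul_apply, RingAut.mul_apply, RingAut.one_apply] at h
  have hL3 : ∀ y : ℂ, y ∈ M → τ₀ (τ₀ y) = y := fun y hy => by
    have h := apply_eq_of_forall_smul_eq i h3 (hM hy)
    rwa [RingAut.mul_apply, RingAut.one_apply] at h
  -- degrees: `[M : ℚ] ∣ 8`, `≠ 8`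
  have h8 : finrank ℚ ↥(normalClosure ℚ (K i) ℂ) = 8 := finrank_normalClosure_complex_eq_eight i h4 hK
  have hdvd : finrank ℚ ↥M ∣ 8 := h8 ▸ IntermediateField.finrank_dvd_of_le_right hM
  have hne8 : finrank ℚ ↥M ≠ 8 := fun h => hne (IntermediateField.eq_of_le_of_finrank_eq hM (by rw [h, h8]))
  by_cases h4M : finrank ℚ ↥M = 4
  · -- `Gal(M/ℚ)` has order `2²`: commutative
    let τQ : ℂ ≃ₐ[ℚ] ℂ := AlgEquiv.ofRingEquiv (f := τ) (ringEquiv_apply_algebraMap₈ _)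
    let τ₀Q : ℂ ≃ₐ[ℚ] ℂ := AlgEquiv.ofRingEquiv (f := τ₀) (ringEquiv_apply_algebraMap₈ _)
    let T : (↥M) ≃ₐ[ℚ] ↥M := τQ.restrictNormal _
    let T₀ : (↥M) ≃ₐ[ℚ] ↥M := τ₀Q.restrictNormal _
    have hT : ∀ y : ↥M, ((T y : ↥M) : ℂ) = τ y := fun y => AlgEquiv.restrictNormal_commutes τQ _ y
    have hT₀ : ∀ y : ↥M, ((T₀ y : ↥M) : ℂ) = τ₀ y := fun y => AlgEquiv.restrictNormal_commutes τ₀Q _ y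
    have hrel : T₀ * T * (T₀ * T) = 1 :=
      AlgEquiv.ext fun y => Subtype.ext (by
        rw [AlgEquiv.mul_apply, AlgEquiv.mul_apply, AlgEquiv.mul_apply, AlgEquiv.one_apply, hT₀, hT, hT₀, hT]
        exact hL2 y y.2)
    have hrel₀ : T₀ * T₀ = 1 :=
      AlgEquiv.ext fun y => Subtype.ext (by rw [AlgEquiv.mul_apply, AlgEquiv.one_apply, hT₀, hT₀]; exact hL3 y y.2)
    haveI : Fact (Nat.Prime 2) := ⟨Nat.prime_two⟩
    have hcomm : IsMulCommutative ((↥M) ≃ₐ[ℚ] ↥M) :=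
      IsPGroup.isMulCommutative_of_card_eq_prime_sq (p := 2) (by rw [IsGalois.card_aut_eq_finrank, h4M]; norm_num)
    have hTT : T * T = 1 := by
      have hc := hcomm.is_comm.comm T T₀
      -- `T₀ T T₀ T = T₀ T₀ T T = T T`
      rw [mul_assoc, ← mul_assoc T T₀ T, hc, mul_assoc, ← mul_assoc, hrel₀, one_mul] at hrel
      exact hrel
    have hy := congrArg (fun e : (↥M) ≃ₐ[ℚ] ↥M => ((e ⟨x, hx⟩ : ↥M) : ℂ)) hTT
    simp only [AlgEquiv.mul_apply, AlgEquiv.one_apply, hT] at hy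
    rw [← hL1 x hx]
    exact hy
  · -- `[M : ℚ] ∈ {1, 2}`: `4 ∤ [M : ℚ]`
    have hdvd' : finrank ℚ ↥M ∣ 2 ^ 3 := by norm_num; exact hdvd
    have h4n : ¬ 4 ∣ finrank ℚ ↥M := by
      intro h4d
      obtain ⟨k, hk, hkM⟩ := (Nat.dvd_prime_pow Nat.prime_two).1 hdvd'
      interval_cases k
      · rw [hkM] at h4d; norm_num at h4d
      · rw [hkM] at h4d; norm_num at h4d
      · exact h4M (by rw [hkM]; norm_num)
      · exact hne8 (by rw [hkM]; norm_num)
    exact conj_apply_eq_of_apply_apply_eq_conj_of_not_dvd M τ hL1 h4n hx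

/-- **Cyclic quartic CM field: every `M ⊊ L = ι(K)` is fixed pointwise by conjugation** (`[M : ℚ] ≤ 2` and conjugation
is a square in the cyclic group of order `4`). [cite: Shimura1998, §8.4 Example (2)(B)] -/
theorem conj_apply_eq_of_ne_normalClosure_of_isCyclic (i : I) [IsGalois ℚ (K i)] [IsCyclic (K i ≃ₐ[ℚ] K i)]
    (h4 : finrank ℚ (K i) = 4) (M : IntermediateField ℚ ℂ) [FiniteDimensional ℚ M] (hM : M ≤ normalClosure ℚ (K i) ℂ)
    (hne : M ≠ normalClosure ℚ (K i) ℂ) {x : ℂ} (hx : x ∈ M) : starRingEnd ℂ x = x := by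
  have hL : finrank ℚ ↥(normalClosure ℚ (K i) ℂ) = 4 := (finrank_normalClosure_of_normal (K := K i)).trans h4
  have hdvd : finrank ℚ ↥M ∣ 4 := hL ▸ IntermediateField.finrank_dvd_of_le_right hM
  have hne4 : finrank ℚ ↥M ≠ 4 := fun h => hne (IntermediateField.eq_of_le_of_finrank_eq hM (by rw [h, hL]))
  have hdvd' : finrank ℚ ↥M ∣ 2 ^ 2 := by norm_num; exact hdvd
  have h2 : finrank ℚ ↥M ≤ 2 := by
    obtain ⟨k, hk, hkM⟩ := (Nat.dvd_prime_pow Nat.prime_two).1 hdvd'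
    interval_cases k
    · rw [hkM]; norm_num
    · rw [hkM]; norm_num
    · exact absurd (by rw [hkM]; norm_num) hne4
  exact conj_apply_eq_of_isSquare_conjGal_of_finrank_le_two (isSquare_conjGal_of_isCyclic (by rw [h4])) M hM h2 hx

/-- **A quartic CM field which is not biquadratic: every normal `M ⊊ L` is fixed pointwise by conjugation** — the two
cases (cyclic Galois; non-Galois). [cite: Shimura1998, §8.4 Example (2) (B), (C)] -/
theorem conj_apply_eq_of_ne_normalClosure_quartic (i : I) (h4 : finrank ℚ (K i) = 4)
    (hK : ¬ (IsGalois ℚ (K i) ∧ ¬ IsCyclic (K i ≃ₐ[ℚ] K i))) (M : IntermediateField ℚ ℂ) [FiniteDimensional ℚ M]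
    [@Normal ℚ M _ _ (IntermediateField.algebra' M)] (hM : M ≤ normalClosure ℚ (K i) ℂ)
    (hne : M ≠ normalClosure ℚ (K i) ℂ) {x : ℂ} (hx : x ∈ M) : starRingEnd ℂ x = x := by
  by_cases hgal : IsGalois ℚ (K i)
  · have hcyc : IsCyclic (K i ≃ₐ[ℚ] K i) := by
      by_contra hc
      exact hK ⟨hgal, hc⟩
    haveI := hgal
    haveI := hcyc
    exact conj_apply_eq_of_ne_normalClosure_of_isCyclic i h4 M hM hne hx
  · exact conj_apply_eq_of_ne_normalClosure_of_not_isGalois i h4 hgal M hM hne hx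

/-- **Two quartic CM fields (not biquadratic) with DIFFERENT Galois closures: conjugation fixes `L₀ ∩ L₁` pointwise** —
`L₀ ∩ L₁` is normal and a proper subfield of `L₀` or of `L₁`. [cite: Shimura1998, §8.4 Example (2)] [cite: Lang2002, VI §1 Cor. 1.4] -/
theorem conj_apply_eq_of_mem_inf_of_normalClosure_ne {i₀ i₁ : I} (h4₀ : finrank ℚ (K i₀) = 4)
    (h4₁ : finrank ℚ (K i₁) = 4) (hK₀ : ¬ (IsGalois ℚ (K i₀) ∧ ¬ IsCyclic (K i₀ ≃ₐ[ℚ] K i₀)))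
    (hK₁ : ¬ (IsGalois ℚ (K i₁) ∧ ¬ IsCyclic (K i₁ ≃ₐ[ℚ] K i₁)))
    (hne : normalClosure ℚ (K i₀) ℂ ≠ normalClosure ℚ (K i₁) ℂ) {x : ℂ} (h₀ : x ∈ normalClosure ℚ (K i₀) ℂ)
    (h₁ : x ∈ normalClosure ℚ (K i₁) ℂ) : starRingEnd ℂ x = x := by
  haveI : ∀ j : I, @Normal ℚ ↥(normalClosure ℚ (K j) ℂ) _ _ (IntermediateField.algebra' _) :=
    normal_normalClosure_complex
  letI : Algebra ℚ ↥(normalClosure ℚ (K i₀) ℂ ⊓ normalClosure ℚ (K i₁) ℂ) := IntermediateField.algebra' _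
  haveI : FiniteDimensional ℚ ↥(normalClosure ℚ (K i₀) ℂ ⊓ normalClosure ℚ (K i₁) ℂ) :=
    finiteDimensional_of_le₈ inf_le_left
  have hx : x ∈ normalClosure ℚ (K i₀) ℂ ⊓ normalClosure ℚ (K i₁) ℂ := IntermediateField.mem_inf.2 ⟨h₀, h₁⟩
  by_cases hM₀ : normalClosure ℚ (K i₀) ℂ ⊓ normalClosure ℚ (K i₁) ℂ = normalClosure ℚ (K i₀) ℂ
  · have hM₁ : normalClosure ℚ (K i₀) ℂ ⊓ normalClosure ℚ (K i₁) ℂ ≠ normalClosure ℚ (K i₁) ℂ :=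
      fun h => hne (hM₀.symm.trans h)
    exact conj_apply_eq_of_ne_normalClosure_quartic i₁ h4₁ hK₁ _ inf_le_right hM₁ hx
  · exact conj_apply_eq_of_ne_normalClosure_quartic i₀ h4₀ hK₀ _ inf_le_left hM₀ hx

/-- A primitive CM type lives on a quartic CM field that is not biquadratic (Galois ⟹ cyclic).
[cite: Shimura1998, §8.4 Example (2)(A)] -/
theorem not_biquadratic_of_isPrimitive (i : I) (h4 : finrank ℚ (K i) = 4) {Φ : CMType (K i)} {φ₀ : K i →+* ℂ}
    (hprim : IsPrimitive (ℂ ≃+* ℂ) Φ.1 φ₀) : ¬ (IsGalois ℚ (K i) ∧ ¬ IsCyclic (K i ≃ₐ[ℚ] K i)) := by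
  rintro ⟨hgal, hc⟩
  haveI := hgal
  exact hc (QuarticCM.isCyclic_of_isPrimitive h4 hprim)

end Fields

/-! ### Abelian surfaces -/

section Geometry

variable {I : Type} {K : I → Type} [∀ i, Field (K i)] [∀ i, NumberField (K i)] [∀ i, IsCMField (K i)] [Fintype I]
  [Nonempty I] {Φ : ∀ i, CMType (K i)}
variable {A : I → AbelianVariety ℂ} {ι : ∀ i, 𝓞 (K i) →+* End (A i)}
  {θ : ∀ i, K i →+* Module.End ℂ (complexBetti (A i).X 1)}

omit [Fintype I] [Nonempty I] in
/-- Every CM type of a quartic CM field that is not biquadratic is nondegenerate (all its types are primitive; Ribet's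
bound in degree `≤ 6`). [cite: Shimura1998, §8.4 Example (2) (B), (C)] -/
theorem isNondegenerate_of_quartic_not_biquadratic (i : I) (h4 : finrank ℚ (K i) = 4)
    (hK : ¬ (IsGalois ℚ (K i) ∧ ¬ IsCyclic (K i ≃ₐ[ℚ] K i))) (Φ : CMType (K i)) : IsNondegenerate Φ := by
  by_cases hgal : IsGalois ℚ (K i)
  · have hcyc : IsCyclic (K i ≃ₐ[ℚ] K i) := by
      by_contra hc
      exact hK ⟨hgal, hc⟩
    haveI := hgal
    haveI := hcyc
    exact isNondegenerate_of_isCyclic_of_finrank_eq_four h4 Φ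
  · obtain ⟨φ₀⟩ : Nonempty (K i →+* ℂ) := inferInstance
    exact isNondegenerate_of_isPrimitive_of_finrank_le_six (Φ := Φ) (by omega) φ₀
      (isPrimitive_of_not_isGalois h4 hgal Φ φ₀)

/-- **Two abelian surfaces with CM by quartic fields (not biquadratic) with DIFFERENT Galois closures: the Hodge
conjecture and `B• = D•` on every `S₀^a × S₁^b`** (every `⨁_{j<N} A_{π j}`) of realisations of ANY CM types —
UNCONDITIONAL: conjugation fixes `L₀ ∩ L₁` (a proper normal subfield of a quartic-CM closure), giving partial
conjugations at both slots, and the types are nondegenerate. [cite: Gordon1999HodgeAVSurvey, §3 Theorem and 10.10]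
[cite: Shimura1998, §8.4 Example (2)] -/
theorem hodgeConjectureFor_prod_surfaces_of_normalClosure_ne {i₀ i₁ : I} (h01 : i₀ ≠ i₁) (hI : ∀ j, j = i₀ ∨ j = i₁)
    (h4₀ : finrank ℚ (K i₀) = 4) (h4₁ : finrank ℚ (K i₁) = 4)
    (hK₀ : ¬ (IsGalois ℚ (K i₀) ∧ ¬ IsCyclic (K i₀ ≃ₐ[ℚ] K i₀)))
    (hK₁ : ¬ (IsGalois ℚ (K i₁) ∧ ¬ IsCyclic (K i₁ ≃ₐ[ℚ] K i₁)))
    (hne : normalClosure ℚ (K i₀) ℂ ≠ normalClosure ℚ (K i₁) ℂ)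
    (hA : ∀ i, IsCMTypeRealisation (Φ i) (A i) (ι i) (θ i)) {N : ℕ} (π : Fin N → I) :
    HodgeConjectureFor (⨁ fun j : Fin N => A (π j)).dim (⨁ fun j : Fin N => A (π j)).X ∧
      ∀ m : ℕ, hodgeClassSpan (⨁ fun j : Fin N => A (π j)).dim (⨁ fun j : Fin N => A (π j)).X m =
        divisorClassesSpan (⨁ fun j : Fin N => A (π j)).X (⨁ fun j : Fin N => A (π j)).dim m := by
  have hreal : ∀ x : ℂ, x ∈ normalClosure ℚ (K i₀) ℂ → x ∈ normalClosure ℚ (K i₁) ℂ → starRingEnd ℂ x = x :=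
    fun x hx₀ hx₁ => conj_apply_eq_of_mem_inf_of_normalClosure_ne h4₀ h4₁ hK₀ hK₁ hne hx₀ hx₁
  have hΦ : ∀ i, IsNondegenerate (Φ i) := fun i => by
    rcases hI i with rfl | rfl
    · exact isNondegenerate_of_quartic_not_biquadratic _ h4₀ hK₀ (Φ _)
    · exact isNondegenerate_of_quartic_not_biquadratic _ h4₁ hK₁ (Φ _)
  exact ⟨hodgeConjectureFor_prod_of_partialConj (forall_exists_partialConj_pair h01 hI hreal) hΦ hA π, fun m =>
    hodgeClassSpan_prod_eq_divisorClassesSpan_of_partialConj (forall_exists_partialConj_pair h01 hI hreal) hΦ hA π m⟩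

/-- **Two SIMPLE CM abelian surfaces whose quartic CM fields have different Galois closures: the Hodge conjecture and
`B• = D•` on every `S₀^a × S₁^b`**, with no further hypothesis (simple ⟹ primitive type ⟹ the field is cyclic or
non-Galois) — e.g. a surface with CM by `ℚ(ζ_5)` times ANY simple CM surface with a different CM field; two surfaces with
non-Galois quartic CM fields of different dihedral closures (even when these share their real biquadratic subfield).
[cite: Gordon1999HodgeAVSurvey, §3 Theorem and 10.10] [cite: MoonenZarhin1999LowDim, Cor. (3.9)] [cite: Shimura1998, §8.4 Example (2)] -/
theorem hodgeConjectureFor_prod_simpleSurfaces_of_normalClosure_ne {i₀ i₁ : I} (h01 : i₀ ≠ i₁)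
    (hI : ∀ j, j = i₀ ∨ j = i₁) (h4 : ∀ i, finrank ℚ (K i) = 4)
    (hne : normalClosure ℚ (K i₀) ℂ ≠ normalClosure ℚ (K i₁) ℂ)
    (hA : ∀ i, IsCMTypeRealisation (Φ i) (A i) (ι i) (θ i)) (hS : ∀ i, (A i).IsSimple) {N : ℕ} (π : Fin N → I) :
    HodgeConjectureFor (⨁ fun j : Fin N => A (π j)).dim (⨁ fun j : Fin N => A (π j)).X ∧
      ∀ m : ℕ, hodgeClassSpan (⨁ fun j : Fin N => A (π j)).dim (⨁ fun j : Fin N => A (π j)).X m =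
        divisorClassesSpan (⨁ fun j : Fin N => A (π j)).X (⨁ fun j : Fin N => A (π j)).dim m := by
  have hK : ∀ i, ¬ (IsGalois ℚ (K i) ∧ ¬ IsCyclic (K i ≃ₐ[ℚ] K i)) := fun i =>
    not_biquadratic_of_isPrimitive i (h4 i)
      ((isSimple_iff_isPrimitive (hA i) (Classical.arbitrary (K i →+* ℂ))).1 (hS i))
  exact hodgeConjectureFor_prod_surfaces_of_normalClosure_ne h01 hI (h4 i₀) (h4 i₁) (hK i₀) (hK i₁) hne hA π

variable [DecidableEq I]

/-- **The Hodge conjecture on every `E_1^{a_1} × ⋯ × E_r^{a_r} × S_1^{c_1} × ⋯ × S_m^{c_m}`** — every `⨁_{k<N} A_{π k}` —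
for pairwise non-isogenous CM elliptic curves `E_j` (the slots off `B = {i | p i}`) and SIMPLE CM abelian surfaces `S_b`
(`b ∈ B`) whose quartic CM fields have PAIRWISE DIFFERENT Galois closures (cyclic or dihedral, in any mixture):
seat p2's pairwise menu (`hodgeConjectureFor_prod_curves_surfaces_of_realIntersection`) with its real-intersection
hypothesis discharged by `conj_apply_eq_of_mem_inf_of_normalClosure_ne`; UNCONDITIONAL, no named fact.
[cite: Gordon1999HodgeAVSurvey, §3 Theorem and 10.10] [cite: MoonenZarhin1999LowDim, Cor. (3.9)] [cite: Shimura1998, §8.4 Example (2)] -/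
theorem hodgeConjectureFor_prod_curves_surfaces_of_normalClosure_ne (p : I → Prop)
    (h2 : ∀ j, ¬p j → finrank ℚ (K j) = 2) (h4 : ∀ b, p b → finrank ℚ (K b) = 4)
    (hsep : CMAlgebra.IsSeparatingFamily (fun j : {j // ¬p j} => Φ j.1))
    (hne : ∀ a b, p a → p b → a ≠ b → normalClosure ℚ (K a) ℂ ≠ normalClosure ℚ (K b) ℂ)
    (hA : ∀ i, IsCMTypeRealisation (Φ i) (A i) (ι i) (θ i)) (hS : ∀ b, p b → (A b).IsSimple) {N : ℕ}
    (π : Fin N → I) : HodgeConjectureFor (⨁ fun j : Fin N => A (π j)).dim (⨁ fun j : Fin N => A (π j)).X := by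
  refine hodgeConjectureFor_prod_curves_surfaces_of_realIntersection p h2 h4 hsep (fun a b ha hb hab x hxa hxb => ?_)
    hA hS π
  have hKa : ¬ (IsGalois ℚ (K a) ∧ ¬ IsCyclic (K a ≃ₐ[ℚ] K a)) :=
    not_biquadratic_of_isPrimitive a (h4 a ha)
      ((isSimple_iff_isPrimitive (hA a) (Classical.arbitrary (K a →+* ℂ))).1 (hS a ha))
  have hKb : ¬ (IsGalois ℚ (K b) ∧ ¬ IsCyclic (K b ≃ₐ[ℚ] K b)) :=
    not_biquadratic_of_isPrimitive b (h4 b hb)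
      ((isSimple_iff_isPrimitive (hA b) (Classical.arbitrary (K b →+* ℂ))).1 (hS b hb))
  exact conj_apply_eq_of_mem_inf_of_normalClosure_ne (h4 a ha) (h4 b hb) hKa hKb (hne a b ha hb hab) hxa hxb

end Geometry

end Summit.HodgeConjecture.CorCM

end
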